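import Mathlib
import Summits.MatrixMultiplication.MatrixMultiplication.Theorems.GradedDesignFamily.Negative.SubfieldCellUnipotent

/-!
# (P5) Borel propagation: if `⟨A⁴ ∩ SL₂⟩` fixes a line and `A² ∩ SL₂` is large, all of `A` fixes it
# (crux `LevelGradedCohnUmans.GradedDesignFamily`, stmt-MatrixMultiplication-7610; negative side,
# line `quadratic-extension-level-one-cell`, unit b2b-lgcu-subfield gen 18)

HONEST FRAMING.  This proves piece (P5) of `structureDichotomy_of_pieces`
(`Negative/SubfieldCellStructure.lean`) verbatim.  For a symmetric `A ∋ 1` in `GL₂(K)` with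
`|A² ∩ SL₂(K)| ≥ c₁|K|² > |K|`: two distinct elements `x ≠ x'` of `A² ∩ SL₂` have the same eigenvalue
on `v` (pigeonhole), so `u = x⁻¹x'` is a non-trivial unipotent fixing `v`; for `a ∈ A` the conjugate
`a u a⁻¹ = (a x a⁻¹)⁻¹ (a x' a⁻¹)` lies in `⟨A⁴ ∩ SL₂⟩`, hence has `v` as an eigenvector, and a
non-trivial unipotent has only one invariant line — so `a v ∈ K·v`
(`fin_two_exists_smul_of_mulVec_eq_zero`).  One elementary input of the Lean reduction of `¬S3`
(THEOREM F′); NOT summit progress.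

Sorry-free. [folklore]
-/

set_option linter.dupNamespace false

open scoped Pointwise

open Matrix

namespace Summit.MatrixMultiplication.MatrixMultiplication.Theorems.GradedDesignFamily.Negative

/-- **(P5) Borel propagation.**  Hypothesis (P5) of `structureDichotomy_of_pieces`, verbatim.
NOT summit progress. [folklore] -/
theorem subfieldCell_borelPropagation :
    ∀ c₁ : ℝ, 0 < c₁ → ∃ Q₇ : ℕ, ∀ (K : Type) [Field K] [Fintype K] [DecidableEq K],
      Q₇ ≤ Fintype.card K → ∀ A : Finset (Matrix.GeneralLinearGroup (Fin 2) K), 1 ∈ A →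
        (↑A : Set (Matrix.GeneralLinearGroup (Fin 2) K))⁻¹ = ↑A →
        c₁ * (Fintype.card K : ℝ) ^ 2 ≤
          ((A ^ 2).filter fun g => Matrix.GeneralLinearGroup.det g = 1).card →
        ∀ v : Fin 2 → K, v ≠ 0 →
          (∀ g ∈ Subgroup.closure
              (↑((A ^ 4).filter fun g => Matrix.GeneralLinearGroup.det g = 1) :
                Set (Matrix.GeneralLinearGroup (Fin 2) K)),
            ∃ t : K, (g : Matrix (Fin 2) (Fin 2) K).mulVec v = t • v) →
          ∀ a ∈ A, ∃ t : K, (a : Matrix (Fin 2) (Fin 2) K).mulVec v = t • v := by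
  intro c₁ hc₁
  refine ⟨⌈1 / c₁⌉₊ + 1, ?_⟩
  intro K _ _ _ hQ A h1 hsymm hA2 v hv hL a ha
  classical
  -- `|K| < |A² ∩ SL₂|`
  have hlt : Fintype.card K < ((A ^ 2).filter fun g => Matrix.GeneralLinearGroup.det g = 1).card := by
    have hQR : (⌈1 / c₁⌉₊ : ℝ) + 1 ≤ (Fintype.card K : ℝ) := by exact_mod_cast hQ
    have hceil := Nat.le_ceil (1 / c₁)
    have hcQ : 1 < c₁ * (Fintype.card K : ℝ) := by
      have h' : 1 / c₁ < (Fintype.card K : ℝ) := by linarith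
      rwa [div_lt_iff₀ hc₁, mul_comm] at h'
    have hQpos : (0 : ℝ) < (Fintype.card K : ℝ) := by
      have : (0 : ℝ) ≤ (⌈1 / c₁⌉₊ : ℝ) := Nat.cast_nonneg _
      linarith
    have hlt' : (Fintype.card K : ℝ) <
        ((A ^ 2).filter fun g => Matrix.GeneralLinearGroup.det g = 1).card := by
      nlinarith
    exact_mod_cast hlt'
  -- inverses stay in `A`
  have hinvA : ∀ g ∈ A, g⁻¹ ∈ A := by
    intro g hg
    have h : g⁻¹ ∈ (↑A : Set (Matrix.GeneralLinearGroup (Fin 2) K))⁻¹ := by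
      rw [Set.mem_inv, inv_inv]; exact Finset.mem_coe.2 hg
    rw [hsymm] at h
    exact Finset.mem_coe.1 h
  -- conjugation by `a ∈ A` maps `A² ∩ SL₂` into `A⁴ ∩ SL₂`
  have hconj : ∀ x ∈ ((A ^ 2).filter fun g => Matrix.GeneralLinearGroup.det g = 1),
      a * x * a⁻¹ ∈ ((A ^ 4).filter fun g => Matrix.GeneralLinearGroup.det g = 1) := by
    intro x hx
    obtain ⟨hx2, hxd⟩ := Finset.mem_filter.1 hx
    rw [Finset.mem_filter]
    refine ⟨?_, ?_⟩
    · have h3 : a * x ∈ A ^ 3 := by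
        rw [pow_succ']; exact Finset.mul_mem_mul ha hx2
      rw [pow_succ]; exact Finset.mul_mem_mul h3 (hinvA a ha)
    · rw [map_mul, map_mul, hxd, mul_one, map_inv, mul_inv_cancel]
  -- elements of `A² ∩ SL₂` lie in `L₄ = ⟨A⁴ ∩ SL₂⟩`, hence have `v` as an eigenvector
  have h24 : ((A ^ 2).filter fun g => Matrix.GeneralLinearGroup.det g = 1) ⊆
      ((A ^ 4).filter fun g => Matrix.GeneralLinearGroup.det g = 1) :=
    Finset.filter_subset_filter _ (Finset.pow_subset_pow_right h1 (by norm_num))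
  choose! tf htf using hL
  have heig : ∀ x ∈ ((A ^ 2).filter fun g => Matrix.GeneralLinearGroup.det g = 1),
      ((x : Matrix.GeneralLinearGroup (Fin 2) K) : Matrix (Fin 2) (Fin 2) K) *ᵥ v = tf x • v :=
    fun x hx => htf x (Subgroup.subset_closure (Finset.mem_coe.2 (h24 hx)))
  -- pigeonhole on the eigenvalue: two distinct elements with the same eigenvalue
  obtain ⟨x, hx, x', hx', hne, htt⟩ := Finset.exists_ne_map_eq_of_card_lt_of_maps_to
    (t := (Finset.univ : Finset K)) (by simpa using hlt) (f := tf) (fun _ _ => Finset.mem_univ _)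
  -- `u = x⁻¹ x'` is a non-trivial unipotent fixing `v`
  have hux : ((x⁻¹ * x' : Matrix.GeneralLinearGroup (Fin 2) K) : Matrix (Fin 2) (Fin 2) K) *ᵥ v = v := by
    rw [Units.val_mul, ← Matrix.mulVec_mulVec, heig x' hx', ← htt, ← heig x hx, Matrix.mulVec_mulVec,
      Units.inv_mul, Matrix.one_mulVec]
  have hu1 : (x⁻¹ * x' : Matrix.GeneralLinearGroup (Fin 2) K) ≠ 1 := by
    intro h; exact hne (inv_mul_eq_one.1 h)
  have hudet : Matrix.det (((x⁻¹ * x' : Matrix.GeneralLinearGroup (Fin 2) K)) :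
      Matrix (Fin 2) (Fin 2) K) = 1 := by
    have h : Matrix.GeneralLinearGroup.det (x⁻¹ * x') = 1 := by
      rw [map_mul, map_inv, (Finset.mem_filter.1 hx).2, (Finset.mem_filter.1 hx').2, inv_one,
        one_mul]
    have h' := congrArg (fun e : Kˣ => (e : K)) h
    simpa only [Matrix.GeneralLinearGroup.val_det_apply, Units.val_one] using h'
  have hN2 := fin_two_sub_one_sq_of_fixed _ hudet v hv hux
  have hN0 : (((x⁻¹ * x' : Matrix.GeneralLinearGroup (Fin 2) K)) : Matrix (Fin 2) (Fin 2) K) - 1 ≠ 0 := by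
    intro h; exact hu1 (Units.val_eq_one.1 (sub_eq_zero.1 h))
  have hNv : ((((x⁻¹ * x' : Matrix.GeneralLinearGroup (Fin 2) K)) : Matrix (Fin 2) (Fin 2) K) - 1) *ᵥ v = 0 := by
    rw [Matrix.sub_mulVec, Matrix.one_mulVec, hux, sub_self]
  -- the conjugate `a u a⁻¹` lies in `L₄`
  have hmem : a * (x⁻¹ * x') * a⁻¹ ∈ Subgroup.closure
      (↑((A ^ 4).filter fun g => Matrix.GeneralLinearGroup.det g = 1) :
        Set (Matrix.GeneralLinearGroup (Fin 2) K)) := by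
    have e : a * (x⁻¹ * x') * a⁻¹ = (a * x * a⁻¹)⁻¹ * (a * x' * a⁻¹) := by group
    rw [e]
    exact Subgroup.mul_mem _ (Subgroup.inv_mem _ (Subgroup.subset_closure (Finset.mem_coe.2 (hconj x hx))))
      (Subgroup.subset_closure (Finset.mem_coe.2 (hconj x' hx')))
  have hw := htf _ hmem
  -- `N' = a N a⁻¹`: non-zero, square zero, kills `a v`; and `v` is an eigenvector of it, so it kills `v`
  have hN'def : ((a * (x⁻¹ * x') * a⁻¹ : Matrix.GeneralLinearGroup (Fin 2) K) : Matrix (Fin 2) (Fin 2) K) - 1 =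
      (a : Matrix (Fin 2) (Fin 2) K) *
        ((((x⁻¹ * x' : Matrix.GeneralLinearGroup (Fin 2) K)) : Matrix (Fin 2) (Fin 2) K) - 1) *
        ((a⁻¹ : Matrix.GeneralLinearGroup (Fin 2) K) : Matrix (Fin 2) (Fin 2) K) := by
    rw [mul_sub, sub_mul, mul_one, Units.mul_inv, Units.val_mul, Units.val_mul]
  have hN'0 : (a : Matrix (Fin 2) (Fin 2) K) *
        ((((x⁻¹ * x' : Matrix.GeneralLinearGroup (Fin 2) K)) : Matrix (Fin 2) (Fin 2) K) - 1) *
        ((a⁻¹ : Matrix.GeneralLinearGroup (Fin 2) K) : Matrix (Fin 2) (Fin 2) K) ≠ 0 := by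
    intro h
    apply hN0
    have h2 : ((a⁻¹ : Matrix.GeneralLinearGroup (Fin 2) K) : Matrix (Fin 2) (Fin 2) K) *
        ((a : Matrix (Fin 2) (Fin 2) K) *
          ((((x⁻¹ * x' : Matrix.GeneralLinearGroup (Fin 2) K)) : Matrix (Fin 2) (Fin 2) K) - 1) *
          ((a⁻¹ : Matrix.GeneralLinearGroup (Fin 2) K) : Matrix (Fin 2) (Fin 2) K)) *
        (a : Matrix (Fin 2) (Fin 2) K) =
        (((x⁻¹ * x' : Matrix.GeneralLinearGroup (Fin 2) K)) : Matrix (Fin 2) (Fin 2) K) - 1 := by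
      calc _ = (((a⁻¹ : Matrix.GeneralLinearGroup (Fin 2) K) : Matrix (Fin 2) (Fin 2) K) *
            (a : Matrix (Fin 2) (Fin 2) K)) *
            ((((x⁻¹ * x' : Matrix.GeneralLinearGroup (Fin 2) K)) : Matrix (Fin 2) (Fin 2) K) - 1) *
            (((a⁻¹ : Matrix.GeneralLinearGroup (Fin 2) K) : Matrix (Fin 2) (Fin 2) K) *
              (a : Matrix (Fin 2) (Fin 2) K)) := by simp only [mul_assoc]
        _ = _ := by rw [Units.inv_mul, one_mul, mul_one]
    rw [h, mul_zero, zero_mul] at h2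
    exact h2.symm
  have hN'sq : (a : Matrix (Fin 2) (Fin 2) K) *
        ((((x⁻¹ * x' : Matrix.GeneralLinearGroup (Fin 2) K)) : Matrix (Fin 2) (Fin 2) K) - 1) *
        ((a⁻¹ : Matrix.GeneralLinearGroup (Fin 2) K) : Matrix (Fin 2) (Fin 2) K) *
      ((a : Matrix (Fin 2) (Fin 2) K) *
        ((((x⁻¹ * x' : Matrix.GeneralLinearGroup (Fin 2) K)) : Matrix (Fin 2) (Fin 2) K) - 1) *
        ((a⁻¹ : Matrix.GeneralLinearGroup (Fin 2) K) : Matrix (Fin 2) (Fin 2) K)) = 0 := by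
    calc _ = (a : Matrix (Fin 2) (Fin 2) K) *
          (((((x⁻¹ * x' : Matrix.GeneralLinearGroup (Fin 2) K)) : Matrix (Fin 2) (Fin 2) K) - 1) *
          (((a⁻¹ : Matrix.GeneralLinearGroup (Fin 2) K) : Matrix (Fin 2) (Fin 2) K) *
            (a : Matrix (Fin 2) (Fin 2) K)) *
          ((((x⁻¹ * x' : Matrix.GeneralLinearGroup (Fin 2) K)) : Matrix (Fin 2) (Fin 2) K) - 1)) *
          ((a⁻¹ : Matrix.GeneralLinearGroup (Fin 2) K) : Matrix (Fin 2) (Fin 2) K) := by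
            simp only [mul_assoc]
      _ = 0 := by rw [Units.inv_mul, mul_one, hN2, mul_zero, zero_mul]
  have hN'av : ((a : Matrix (Fin 2) (Fin 2) K) *
        ((((x⁻¹ * x' : Matrix.GeneralLinearGroup (Fin 2) K)) : Matrix (Fin 2) (Fin 2) K) - 1) *
        ((a⁻¹ : Matrix.GeneralLinearGroup (Fin 2) K) : Matrix (Fin 2) (Fin 2) K)) *ᵥ
      ((a : Matrix (Fin 2) (Fin 2) K) *ᵥ v) = 0 := by
    rw [Matrix.mulVec_mulVec, mul_assoc, Units.inv_mul, mul_one, ← Matrix.mulVec_mulVec, hNv,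
      Matrix.mulVec_zero]
  have hN'v : ((a : Matrix (Fin 2) (Fin 2) K) *
        ((((x⁻¹ * x' : Matrix.GeneralLinearGroup (Fin 2) K)) : Matrix (Fin 2) (Fin 2) K) - 1) *
        ((a⁻¹ : Matrix.GeneralLinearGroup (Fin 2) K) : Matrix (Fin 2) (Fin 2) K)) *ᵥ v =
      (tf (a * (x⁻¹ * x') * a⁻¹) - 1) • v := by
    rw [← hN'def, Matrix.sub_mulVec, Matrix.one_mulVec, hw, sub_smul, one_smul]
  have hs : tf (a * (x⁻¹ * x') * a⁻¹) - 1 = 0 := by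
    have h2 : ((tf (a * (x⁻¹ * x') * a⁻¹) - 1) * (tf (a * (x⁻¹ * x') * a⁻¹) - 1)) • v = 0 := by
      rw [mul_smul, ← hN'v, ← Matrix.mulVec_smul, ← hN'v, Matrix.mulVec_mulVec, hN'sq,
        Matrix.zero_mulVec]
    exact mul_self_eq_zero.1 ((smul_eq_zero.1 h2).resolve_right hv)
  rw [hs, zero_smul] at hN'v
  exact fin_two_exists_smul_of_mulVec_eq_zero _ hN'0 v _ hv hN'v hN'av

end Summit.MatrixMultiplication.MatrixMultiplication.Theorems.GradedDesignFamily.Negative
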